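import Mathlib
import Literature.NumberTheory.Transcendental.KZRayDilog
import Literature.NumberTheory.Transcendental.KZIdealTetrahedron
import Literature.NumberTheory.Transcendental.KZCalculusProofs
import Literature.NumberTheory.Transcendental.SemialgebraicMapsProofs
import Literature.NumberTheory.Transcendental.KZSemialgebraicComplex

/-!
# `OffTetraSectorKernel`, line `flat-shadow`: scaling Zagier's ray domain (stub `stub_rayScale`)

Stub `stub_rayScale` of the crux `OffTetraSectorKernel` (stmt-KontsevichZagierPeriods-10557, route
HyperbolicBloch): Kontsevich–Zagier's rule (2) for the SCALING of Zagier's ray representation of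
the Bloch–Wigner dilogarithm. Notation: `z = a + ib` algebraic, `b > 0`, `N = |z|² = a² + b²`,
`Q(s) = (1 − sa)² + (sb)² > 0`; coordinates `w 0 = s`, `w 1 = u` on the ray domain
`KZ.rayDilogDomain a b = {0 < s < 1, u strictly between 1 and s² N}` (both sheets) with Zagier's
ray integrand `KZ.rayDilogIntegrand a b (s, u) = sgn(u − 1)·(−b)/(2 u Q(s))`, and `w 0 = s`,
`w 1 = v` on the scaled-ray cell. The map `Φ(s, u) = (s, u(1 − s)/s)` is `ℚ`-semialgebraic
(coordinates are quotients of rational polynomials, denominator `s ≠ 0`), injective on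
`{0 < s < 1}` (inverse `u = v s/(1 − s)`), has derivative `[[1, 0], [−u/s², (1 − s)/s]]` of
determinant `(1 − s)/s > 0`, and maps the ray domain ONTO the scaled-ray cell
`R' = {0 < s < 1, v strictly between N s(1 − s) and (1 − s)/s}` (the sheet `s² N < u < 1` goes to
`N s(1 − s) < v, v s < 1 − s`, the sheet `1 < u < s² N` to `1 − s < v s, v < N s(1 − s)`).
Since `1 − s − v s = (1 − s)(1 − u)` and `1 − s > 0`, the Jacobian identity
`sgn(u − 1)·(−b)/(2 u Q) = [sgn(1 − s − v s)·b/(2 Q v)]·(1 − s)/s` (`v = u(1 − s)/s`) makes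
`[ray] − [R']` ONE element of `KZ.changeOfVariablesRel`, and a representation on `R'` with
integrand `sgn(1 − s − v s)·b/(2 Q(s) v)` EXISTS: `R' = Φ(ray domain)` is `ℚ`-semialgebraic by
Tarski–Seidenberg (`IsSemialgebraicMapOn.isSemialgebraic_image_holds`), the integrand is a sign
glued from two constants times a quotient with real-algebraic coefficients and denominator
`2 Q v > 0`, and it is integrable on `Φ(ray domain)` by Mathlib's change-of-variables criterion
`MeasureTheory.integrableOn_image_iff_integrableOn_abs_det_fderiv_smul` (the pulled-back density
IS the ray integrand).

References: M. Kontsevich, D. Zagier, *Periods* (2001), §1.2 rule (2); D. Zagier, *The dilogarithm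
function* (2007), Ch. I §3; J. Bochnak, M. Coste, M.-F. Roy, *Real Algebraic Geometry* (1998), §2.2
(Prop. 2.2.6, 2.2.7).
-/

noncomputable section

open Set MeasureTheory MvPolynomial
open Literature.NumberTheory.Transcendental Literature.ModelTheory.ExponentialFields

namespace Summit.KontsevichZagierPeriods.HyperbolicBloch.OffTetraSectorKernel

variable {z : ℂ}

/-! ## Algebra of the scaling -/

/-- The coordinates of the scaling `Φ(s, u) = (s, u(1 − s)/s)`. [folklore] -/
theorem rayScale_apply (Φ : (Fin 2 → ℝ) → (Fin 2 → ℝ))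
    (hΦ : ∀ w, Φ w = ![w 0, w 1 * (1 - w 0) / w 0]) (w : Fin 2 → ℝ) :
    Φ w 0 = w 0 ∧ Φ w 1 = w 1 * (1 - w 0) / w 0 := by
  rw [hΦ]
  exact ⟨rfl, rfl⟩

/-- **The image of Zagier's ray domain under the scaling is the scaled-ray cell**
`{0 < s < 1, (N s(1 − s) < v ∧ v s < 1 − s) ∨ (1 − s < v s ∧ v < N s(1 − s))}`, `N = |z|²`:
for fixed `s ∈ (0, 1)`, `u ↦ u(1 − s)/s` is an increasing linear bijection with inverse
`v ↦ v s/(1 − s)`, sending `1 ↦ (1 − s)/s` and `s² N ↦ N s(1 − s)`.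
[cite: Zagier2007Dilogarithm, Ch. I §3] -/
theorem rayScale_image (Φ : (Fin 2 → ℝ) → (Fin 2 → ℝ))
    (hΦ : ∀ w, Φ w = ![w 0, w 1 * (1 - w 0) / w 0]) (z : ℂ) :
    Φ '' KZ.rayDilogDomain z.re z.im = {w | 0 < w 0 ∧ w 0 < 1 ∧ ((Complex.normSq z * w 0 * (1 - w 0) < w 1 ∧ w 1 * w 0 < 1 - w 0) ∨ (1 - w 0 < w 1 * w 0 ∧ w 1 < Complex.normSq z * w 0 * (1 - w 0)))} := by
  ext w
  constructor
  · -- `Φ` maps the ray domain into the cell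
    rintro ⟨x, ⟨h0, h1, hsh⟩, rfl⟩
    obtain ⟨e0, e1⟩ := rayScale_apply Φ hΦ x
    simp only [mem_setOf_eq, e0, e1]
    have h1' : (0 : ℝ) < 1 - x 0 := by linarith
    have hvs : x 1 * (1 - x 0) / x 0 * x 0 = x 1 * (1 - x 0) := div_mul_cancel₀ _ h0.ne'
    refine ⟨h0, h1, ?_⟩
    rcases hsh with ⟨hu1, huV⟩ | ⟨hVu, hu1⟩
    · refine Or.inr ⟨?_, ?_⟩
      · rw [hvs]
        exact (lt_mul_iff_one_lt_left h1').mpr hu1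
      · refine (div_lt_iff₀ h0).mpr ?_
        calc x 1 * (1 - x 0) < x 0 ^ 2 * (z.re ^ 2 + z.im ^ 2) * (1 - x 0) :=
              mul_lt_mul_of_pos_right huV h1'
          _ = Complex.normSq z * x 0 * (1 - x 0) * x 0 := by
              rw [Complex.normSq_apply]
              ring
    · refine Or.inl ⟨?_, ?_⟩
      · refine (lt_div_iff₀ h0).mpr ?_
        calc Complex.normSq z * x 0 * (1 - x 0) * x 0
              = x 0 ^ 2 * (z.re ^ 2 + z.im ^ 2) * (1 - x 0) := by
              rw [Complex.normSq_apply]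
              ring
          _ < x 1 * (1 - x 0) := mul_lt_mul_of_pos_right hVu h1'
      · rw [hvs]
        exact (mul_lt_iff_lt_one_left h1').mpr hu1
  · -- the cell is covered: `u = v s/(1 − s)`
    rintro ⟨h0, h1, hsh⟩
    have h1' : (0 : ℝ) < 1 - w 0 := by linarith
    refine ⟨![w 0, w 1 * w 0 / (1 - w 0)], ?_, ?_⟩
    · simp only [KZ.rayDilogDomain, mem_setOf_eq, Matrix.cons_val_zero, Matrix.cons_val_one,
        Matrix.cons_val_fin_one]
      refine ⟨h0, h1, ?_⟩
      rcases hsh with ⟨hM, hc⟩ | ⟨hc, hM⟩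
      · refine Or.inr ⟨?_, (div_lt_one h1').mpr hc⟩
        refine (lt_div_iff₀ h1').mpr ?_
        calc w 0 ^ 2 * (z.re ^ 2 + z.im ^ 2) * (1 - w 0)
              = Complex.normSq z * w 0 * (1 - w 0) * w 0 := by
              rw [Complex.normSq_apply]
              ring
          _ < w 1 * w 0 := mul_lt_mul_of_pos_right hM h0
      · refine Or.inl ⟨(one_lt_div h1').mpr hc, ?_⟩
        refine (div_lt_iff₀ h1').mpr ?_
        calc w 1 * w 0 < Complex.normSq z * w 0 * (1 - w 0) * w 0 := mul_lt_mul_of_pos_right hM h0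
          _ = w 0 ^ 2 * (z.re ^ 2 + z.im ^ 2) * (1 - w 0) := by
              rw [Complex.normSq_apply]
              ring
    · rw [hΦ]
      funext i
      fin_cases i
      · simp
      · simp only [Fin.mk_one, Fin.isValue, Matrix.cons_val_one, Matrix.cons_val_zero,
          Matrix.cons_val_fin_one]
        field_simp

/-- The scaling is injective on every `σ ⊆ {0 < s < 1}`: the first coordinate is kept and, for
fixed `s`, the second is linear in `u` with slope `(1 − s)/s ≠ 0`. [folklore] -/
theorem rayScale_injOn (Φ : (Fin 2 → ℝ) → (Fin 2 → ℝ))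
    (hΦ : ∀ w, Φ w = ![w 0, w 1 * (1 - w 0) / w 0]) {σ : Set (Fin 2 → ℝ)}
    (hσ : σ ⊆ {w | 0 < w 0 ∧ w 0 < 1}) : InjOn Φ σ := by
  intro w hw w' _ h
  obtain ⟨h0, h1⟩ := hσ hw
  obtain ⟨e0, e1⟩ := rayScale_apply Φ hΦ w
  obtain ⟨e0', e1'⟩ := rayScale_apply Φ hΦ w'
  have hs : w 0 = w' 0 := by rw [← e0, ← e0', h]
  have hv : Φ w 1 = Φ w' 1 := by rw [h]
  rw [e1, e1', ← hs, mul_div_assoc, mul_div_assoc] at hv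
  have hk : (1 - w 0) / w 0 ≠ 0 := (div_pos (by linarith) h0).ne'
  have hu : w 1 = w' 1 := mul_right_cancel₀ hk hv
  funext i
  fin_cases i
  exacts [hs, hu]

/-! ## Semialgebraicity -/

/-- The scaling is a `ℚ`-semialgebraic map on every `ℚ`-semialgebraic `σ ⊆ {s > 0}`: its
coordinates are the rational polynomial `X₀` and the quotient `X₁ (1 − X₀) / X₀` whose denominator
does not vanish on `σ`. [cite: BochnakCosteRoy1998, §2.2] -/
theorem rayScale_isSemialgebraicMapOn (Φ : (Fin 2 → ℝ) → (Fin 2 → ℝ))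
    (hΦ : ∀ w, Φ w = ![w 0, w 1 * (1 - w 0) / w 0]) {σ : Set (Fin 2 → ℝ)}
    (hσ : IsSemialgebraic ℚ σ) (hpos : σ ⊆ {w | 0 < w 0}) : IsSemialgebraicMapOn ℚ σ Φ := by
  have hq0 : ∀ w ∈ σ, aeval w (X 0 : MvPolynomial (Fin 2) ℚ) ≠ 0 := fun w hw => by
    have h0 : (0 : ℝ) < w 0 := hpos hw
    simpa using h0.ne'
  refine IsSemialgebraicMapOn.of_forall hσ fun j => ?_
  fin_cases j
  · exact (isSemialgebraicFunOn_aeval hσ (X 0)).congr fun w _ => by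
      simp [(rayScale_apply Φ hΦ w).1]
  · exact (isSemialgebraicFunOn_aeval_div_aeval hσ (X 1 * (1 - X 0)) (X 0) hq0).congr
      fun w _ => by simp [(rayScale_apply Φ hΦ w).2]

/-- The sign factor `sgn(1 − s − v s)` (as `if v s < 1 − s then 1 else −1`) is a `ℚ`-semialgebraic
function on `ℝ²`: two constants glued along the `ℚ`-semialgebraic set `{v s < 1 − s}` and its
complement. [folklore] -/
theorem rayScale_sign_isSemialgebraicFunOn :
    IsSemialgebraicFunOn ℚ (univ : Set (Fin 2 → ℝ))
      (fun w => if w 1 * w 0 < 1 - w 0 then (1 : ℝ) else -1) := by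
  have hP : IsSemialgebraic ℚ {w : Fin 2 → ℝ | w 1 * w 0 < 1 - w 0} := by
    have h := isSemialgebraic_setOf_eval_lt (k := ℚ) (R := ℝ)
      (X 1 * X 0 : MvPolynomial (Fin 2) ℚ) (1 - X 0)
    simp only [map_mul, map_sub, map_one, MvPolynomial.aeval_X] at h
    exact h
  have hf : IsSemialgebraicFunOn ℚ {w : Fin 2 → ℝ | w 1 * w 0 < 1 - w 0} (fun _ => (1 : ℝ)) := by
    simpa using isSemialgebraicFunOn_natCast hP 1
  have hg : IsSemialgebraicFunOn ℚ {w : Fin 2 → ℝ | w 1 * w 0 < 1 - w 0}ᶜ (fun _ => (-1 : ℝ)) :=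
    (isSemialgebraicFunOn_natCast hP.compl 1).neg.congr fun w _ => by simp
  have h := IsSemialgebraicFunOn.union hf hg
    (F := fun w => if w 1 * w 0 < 1 - w 0 then (1 : ℝ) else -1)
    (fun w hw => by simp only [mem_setOf_eq] at hw; simp [hw])
    (fun w hw => by simp only [mem_compl_iff, mem_setOf_eq] at hw; simp [hw])
  rwa [union_compl_self] at h

/-- The scaled-ray density `sgn(1 − s − v s)·b/(2 Q(s) v)` is a `ℚ`-semialgebraic function on
every `ℚ`-semialgebraic `σ ⊆ {v > 0}` for algebraic `Re z`, `Im z ≠ 0`: the semialgebraic sign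
factor times a quotient of polynomials with real-algebraic coefficients
(`isSemialgebraicFunOn_const_of_isAlgebraic`) whose denominator `2 Q(s) v` does not vanish on `σ`.
[cite: KontsevichZagier2001, §1.1] -/
theorem rayScale_isSemialgebraicFunOn (hre : IsAlgebraic ℚ z.re) (him : IsAlgebraic ℚ z.im)
    (hz : 0 < z.im) {σ : Set (Fin 2 → ℝ)} (hσ : IsSemialgebraic ℚ σ) (hpos : ∀ w ∈ σ, 0 < w 1) :
    IsSemialgebraicFunOn ℚ σ (fun w => (if w 1 * w 0 < 1 - w 0 then (1 : ℝ) else -1) * z.im /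
      (2 * ((1 - w 0 * z.re) ^ 2 + (w 0 * z.im) ^ 2) * w 1)) := by
  have s0 : IsSemialgebraicFunOn ℚ σ (fun w => w 0) :=
    (isSemialgebraicFunOn_aeval hσ (X 0)).congr fun w _ => by simp
  have s1 : IsSemialgebraicFunOn ℚ σ (fun w => w 1) :=
    (isSemialgebraicFunOn_aeval hσ (X 1)).congr fun w _ => by simp
  have sone : IsSemialgebraicFunOn ℚ σ (fun _ => (1 : ℝ)) := by
    simpa using isSemialgebraicFunOn_natCast (k := ℚ) (R := ℝ) hσ 1
  have stwo : IsSemialgebraicFunOn ℚ σ (fun _ => (2 : ℝ)) := by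
    simpa using isSemialgebraicFunOn_natCast (k := ℚ) (R := ℝ) hσ 2
  have sre : IsSemialgebraicFunOn ℚ σ (fun _ => z.re) :=
    isSemialgebraicFunOn_const_of_isAlgebraic hσ hre
  have sim : IsSemialgebraicFunOn ℚ σ (fun _ => z.im) :=
    isSemialgebraicFunOn_const_of_isAlgebraic hσ him
  have sQa := IsSemialgebraicFunOn.sub_holds sone (IsSemialgebraicFunOn.mul_holds s0 sre)
  have sQb := IsSemialgebraicFunOn.mul_holds s0 sim
  have sden : IsSemialgebraicFunOn ℚ σ
      (fun w => 2 * ((1 - w 0 * z.re) ^ 2 + (w 0 * z.im) ^ 2) * w 1) := by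
    refine (IsSemialgebraicFunOn.mul_holds (IsSemialgebraicFunOn.mul_holds stwo
      (IsSemialgebraicFunOn.add_holds (IsSemialgebraicFunOn.mul_holds sQa sQa)
        (IsSemialgebraicFunOn.mul_holds sQb sQb))) s1).congr fun w _ => ?_
    simp only [Pi.mul_apply, Pi.add_apply, Pi.sub_apply]
    ring
  have hsign := rayScale_sign_isSemialgebraicFunOn.mono (subset_univ σ) hσ
  have h := (IsSemialgebraicFunOn.mul_holds hsign sim).div sden fun w hw =>
    (mul_pos (mul_pos two_pos (KZ.rayDilog_den_pos hz.ne' z.re (w 0))) (hpos w hw)).ne'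
  exact h.congr fun _ _ => rfl

/-! ## The derivative -/

/-- **The derivative of the scaling and its determinant.** At a point with `s ≠ 0`, `Φ` has the
Fréchet derivative of matrix `[[1, 0], [−u/s², (1 − s)/s]]`, of determinant `(1 − s)/s`.
[folklore] -/
theorem rayScale_hasFDerivAt_det (Φ : (Fin 2 → ℝ) → (Fin 2 → ℝ))
    (hΦ : ∀ w, Φ w = ![w 0, w 1 * (1 - w 0) / w 0]) {x : Fin 2 → ℝ} (hx : x 0 ≠ 0) :
    ∃ L : (Fin 2 → ℝ) →L[ℝ] (Fin 2 → ℝ), HasFDerivAt Φ L x ∧ L.det = (1 - x 0) / x 0 := by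
  set M : Matrix (Fin 2) (Fin 2) ℝ := !![1, 0; -x 1 / x 0 ^ 2, (1 - x 0) / x 0] with hM
  refine ⟨LinearMap.toContinuousLinearMap (Matrix.toLin' M), ?_, ?_⟩
  · -- derivative, componentwise
    have e0 : HasFDerivAt (fun y : Fin 2 → ℝ => y 0) (ContinuousLinearMap.proj 0) x :=
      hasFDerivAt_apply (𝕜 := ℝ) 0 x
    have e1 : HasFDerivAt (fun y : Fin 2 → ℝ => y 1) (ContinuousLinearMap.proj 1) x :=
      hasFDerivAt_apply (𝕜 := ℝ) 1 x
    have h0 : HasFDerivAt (fun y => Φ y 0)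
        ((ContinuousLinearMap.proj 0).comp (LinearMap.toContinuousLinearMap (Matrix.toLin' M)))
        x := by
      have hf : (fun y => Φ y 0) = fun y : Fin 2 → ℝ => y 0 := by
        funext y
        exact (rayScale_apply Φ hΦ y).1
      rw [hf]
      refine e0.congr_fderiv (ContinuousLinearMap.ext fun u => ?_)
      simp [hM, Matrix.toLin'_apply, dotProduct, Fin.sum_univ_two]
    have h1 : HasFDerivAt (fun y => Φ y 1)
        ((ContinuousLinearMap.proj 1).comp (LinearMap.toContinuousLinearMap (Matrix.toLin' M)))
        x := by
      have hf : (fun y => Φ y 1) = fun y : Fin 2 → ℝ =>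
          y 1 * (1 - y 0) * ((fun t : ℝ => t⁻¹) ∘ fun y : Fin 2 → ℝ => y 0) y := by
        funext y
        rw [(rayScale_apply Φ hΦ y).2, div_eq_mul_inv]
        rfl
      rw [hf]
      have hinv := (hasDerivAt_inv hx).comp_hasFDerivAt x e0
      have hcomp := (e1.fun_mul (e0.const_sub 1)).fun_mul hinv
      refine hcomp.congr_fderiv (ContinuousLinearMap.ext fun u => ?_)
      simp [hM, Matrix.toLin'_apply, dotProduct, Fin.sum_univ_two]
      field_simp
      ring
    refine hasFDerivAt_pi'' fun i => ?_
    fin_cases i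
    exacts [h0, h1]
  · -- determinant
    rw [LinearMap.det_toContinuousLinearMap, LinearMap.det_toLin', Matrix.det_fin_two]
    simp [hM]

/-- **Scaling move data on Zagier's ray representation**: a derivative `Φ'` within the ray domain
at every point of it together with the Jacobian identity
`sgn(u − 1)·(−b)/(2 u Q(s)) = sgn(1 − s − v s)·b/(2 Q(s) v) · |det Φ'|` at `v = u(1 − s)/s`,
`|det Φ'| = (1 − s)/s` (`1 − s − v s = (1 − s)(1 − u)`, `1 − s > 0`, `u ≠ 1` on the domain).
[cite: KontsevichZagier2001, §1.2 rule (2)] -/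
theorem rayScale_moveData (Φ : (Fin 2 → ℝ) → (Fin 2 → ℝ))
    (hΦ : ∀ w, Φ w = ![w 0, w 1 * (1 - w 0) / w 0]) (hz : 0 < z.im) :
    ∃ Φ' : (Fin 2 → ℝ) → ((Fin 2 → ℝ) →L[ℝ] (Fin 2 → ℝ)), ∀ x ∈ KZ.rayDilogDomain z.re z.im,
      HasFDerivWithinAt Φ (Φ' x) (KZ.rayDilogDomain z.re z.im) x ∧
      KZ.rayDilogIntegrand z.re z.im x =
        (if Φ x 1 * Φ x 0 < 1 - Φ x 0 then (1 : ℝ) else -1) * z.im /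
          (2 * ((1 - Φ x 0 * z.re) ^ 2 + (Φ x 0 * z.im) ^ 2) * Φ x 1) * |(Φ' x).det| := by
  have hex : ∀ x : Fin 2 → ℝ, ∃ L : (Fin 2 → ℝ) →L[ℝ] (Fin 2 → ℝ),
      x 0 ≠ 0 → HasFDerivAt Φ L x ∧ L.det = (1 - x 0) / x 0 := by
    intro x
    by_cases hx : x 0 = 0
    · exact ⟨0, fun h => (h hx).elim⟩
    · obtain ⟨L, hL, hdet⟩ := rayScale_hasFDerivAt_det Φ hΦ hx
      exact ⟨L, fun _ => ⟨hL, hdet⟩⟩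
  choose Φ' hΦ' using hex
  refine ⟨Φ', fun x hx => ?_⟩
  have h0 : 0 < x 0 := hx.1
  have h1' : (0 : ℝ) < 1 - x 0 := by linarith [hx.2.1]
  have hu : 0 < x 1 := KZ.pos_of_mem_rayDilogDomain z.re z.im hx
  have hQ : 0 < (1 - x 0 * z.re) ^ 2 + (x 0 * z.im) ^ 2 := KZ.rayDilog_den_pos hz.ne' z.re (x 0)
  obtain ⟨hL, hdet⟩ := hΦ' x h0.ne'
  refine ⟨hL.hasFDerivWithinAt, ?_⟩
  obtain ⟨e0, e1⟩ := rayScale_apply Φ hΦ x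
  have hiff : x 1 * (1 - x 0) / x 0 * x 0 < 1 - x 0 ↔ x 1 < 1 := by
    rw [div_mul_cancel₀ _ h0.ne', mul_lt_iff_lt_one_left h1']
  have h0' : x 0 ≠ 0 := h0.ne'
  have h1'' : 1 - x 0 ≠ 0 := h1'.ne'
  have hu' : x 1 ≠ 0 := hu.ne'
  have hQ' : (1 - x 0 * z.re) ^ 2 + (x 0 * z.im) ^ 2 ≠ 0 := hQ.ne'
  rw [hdet, e0, e1, abs_of_pos (div_pos h1' h0), KZ.rayDilogIntegrand]
  rcases hx.2.2 with ⟨hu1, -⟩ | ⟨-, hu1⟩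
  · -- the sheet `1 < u`: `sgn(u − 1) = 1`, `sgn(1 − s − v s) = −1`
    rw [if_pos hu1, if_neg fun h => lt_asymm hu1 (hiff.mp h)]
    field_simp
  · -- the sheet `u < 1`
    rw [if_neg (not_lt.mpr hu1.le), if_pos (hiff.mpr hu1)]
    field_simp

/-! ## The stub -/

/-- **STUB `stub_rayScale`** (scaled ray; Kontsevich–Zagier's rule (2) for the scaling
`Φ(s, u) = (s, u(1 − s)/s)` of Zagier's ray domain onto the scaled-ray cell
`R' = {0 < s < 1, v strictly between |z|² s(1 − s) and (1 − s)/s}`). For algebraic `z` with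
`Im z > 0` and every representation `r = [ray domain, ray integrand]`: a representation
`[R', sgn(1 − s − v s)·b/(2 Q(s) v)]` EXISTS (semialgebraic image by Tarski–Seidenberg; sign glued
from two constants times a quotient with real-algebraic coefficients and denominator `2 Q v > 0`;
integrable by the change-of-variables criterion, the pulled-back density being the ray integrand),
and EVERY such representation `R` is KZ-equivalent to `r` by the single move
`[r] − [R] ∈ changeOfVariablesRel` (`Φ` semialgebraic, injective on `{0 < s < 1}`, derivative
`[[1, 0], [−u/s², (1 − s)/s]]`, image `R'`, ray integrand `= R.integrand ∘ Φ · |det DΦ|`).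
[cite: KontsevichZagier2001, §1.2 rule (2)] -/
theorem stub_rayScale : ∀ z : ℂ, IsAlgebraic ℚ z → 0 < z.im → ∀ r : Literature.NumberTheory.Transcendental.KZ.IntegralRep 2, r.domain = Literature.NumberTheory.Transcendental.KZ.rayDilogDomain z.re z.im → Set.EqOn r.integrand (Literature.NumberTheory.Transcendental.KZ.rayDilogIntegrand z.re z.im) r.domain → (∃ R : Literature.NumberTheory.Transcendental.KZ.IntegralRep 2, R.domain = {w | 0 < w 0 ∧ w 0 < 1 ∧ ((Complex.normSq z * w 0 * (1 - w 0) < w 1 ∧ w 1 * w 0 < 1 - w 0) ∨ (1 - w 0 < w 1 * w 0 ∧ w 1 < Complex.normSq z * w 0 * (1 - w 0)))} ∧ Set.EqOn R.integrand (fun w => (if w 1 * w 0 < 1 - w 0 then (1 : ℝ) else -1) * z.im / (2 * ((1 - w 0 * z.re) ^ 2 + (w 0 * z.im) ^ 2) * w 1)) R.domain) ∧ (∀ R : Literature.NumberTheory.Transcendental.KZ.IntegralRep 2, R.domain = {w | 0 < w 0 ∧ w 0 < 1 ∧ ((Complex.normSq z * w 0 * (1 - w 0) < w 1 ∧ w 1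 * w 0 < 1 - w 0) ∨ (1 - w 0 < w 1 * w 0 ∧ w 1 < Complex.normSq z * w 0 * (1 - w 0)))} → Set.EqOn R.integrand (fun w => (if w 1 * w 0 < 1 - w 0 then (1 : ℝ) else -1) * z.im / (2 * ((1 - w 0 * z.re) ^ 2 + (w 0 * z.im) ^ 2) * w 1)) R.domain → Literature.NumberTheory.Transcendental.KZ.Equivalent r R) := by
  intro z hz him r hr hri
  obtain ⟨hre, him'⟩ := isAlgebraic_re_im hz
  -- the move `Φ(s, u) = (s, u(1 − s)/s)`
  obtain ⟨Φ, hΦ⟩ : ∃ Φ : (Fin 2 → ℝ) → (Fin 2 → ℝ), ∀ w, Φ w = ![w 0, w 1 * (1 - w 0) / w 0] :=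
    ⟨_, fun _ => rfl⟩
  -- the ray domain lies in the strip `0 < s < 1`
  have hsub : r.domain ⊆ {w | 0 < w 0 ∧ w 0 < 1} := fun w hw => by
    rw [hr] at hw
    exact ⟨hw.1, hw.2.1⟩
  -- the image is the scaled-ray cell
  have himage : Φ '' r.domain = {w | 0 < w 0 ∧ w 0 < 1 ∧ ((Complex.normSq z * w 0 * (1 - w 0) < w 1 ∧ w 1 * w 0 < 1 - w 0) ∨ (1 - w 0 < w 1 * w 0 ∧ w 1 < Complex.normSq z * w 0 * (1 - w 0)))} := by
    rw [hr]
    exact rayScale_image Φ hΦ z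
  -- the four data of the move
  have hΦsa : IsSemialgebraicMapOn ℚ r.domain Φ :=
    rayScale_isSemialgebraicMapOn Φ hΦ r.isSemialgebraic_domain fun w hw => (hsub hw).1
  have hinj : InjOn Φ r.domain := rayScale_injOn Φ hΦ hsub
  obtain ⟨Φ', hΦ'⟩ := rayScale_moveData Φ hΦ him
  have hderiv : ∀ x ∈ r.domain, HasFDerivWithinAt Φ (Φ' x) r.domain x := by
    rw [hr]
    exact fun x hx => (hΦ' x hx).1
  have hjac : ∀ x ∈ r.domain, r.integrand x =
      (if Φ x 1 * Φ x 0 < 1 - Φ x 0 then (1 : ℝ) else -1) * z.im /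
        (2 * ((1 - Φ x 0 * z.re) ^ 2 + (Φ x 0 * z.im) ^ 2) * Φ x 1) * |(Φ' x).det| := by
    intro x hx
    have hx' : x ∈ KZ.rayDilogDomain z.re z.im := hr ▸ hx
    rw [hri hx]
    exact (hΦ' x hx').2
  have hmeas : MeasurableSet r.domain := KZ.IntegralRep.measurableSet_domain_holds r
  -- EXISTENCE of `[R', sgn·b/(2 Q v)]`: semialgebraic image, glued quotient, change of variables
  have hT : IsSemialgebraic ℚ (Φ '' r.domain) :=
    IsSemialgebraicMapOn.isSemialgebraic_image_holds hΦsa subset_rfl r.isSemialgebraic_domain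
  have hN : 0 < Complex.normSq z := Complex.normSq_pos.mpr fun h => by
    rw [h] at him
    simp at him
  have hpos : ∀ w ∈ Φ '' r.domain, 0 < w 1 := by
    rw [himage]
    rintro w ⟨h0, h1, ⟨hM, -⟩ | ⟨hc, -⟩⟩
    · exact (mul_pos (mul_pos hN h0) (by linarith)).trans hM
    · have h1' : (0 : ℝ) < 1 - w 0 := by linarith
      refine lt_of_mul_lt_mul_right ?_ h0.le
      rw [zero_mul]
      exact h1'.trans hc
  have hF := rayScale_isSemialgebraicFunOn hre him' him hT hpos
  have hI : IntegrableOn (fun w : Fin 2 → ℝ => (if w 1 * w 0 < 1 - w 0 then (1 : ℝ) else -1) *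
      z.im / (2 * ((1 - w 0 * z.re) ^ 2 + (w 0 * z.im) ^ 2) * w 1)) (Φ '' r.domain) := by
    rw [integrableOn_image_iff_integrableOn_abs_det_fderiv_smul volume hmeas hderiv hinj]
    refine r.integrableOn.congr_fun (fun x hx => ?_) hmeas
    rw [hjac x hx, smul_eq_mul, mul_comm]
  refine ⟨⟨⟨Φ '' r.domain, _, hT, hF, hI⟩, himage, fun _ _ => rfl⟩, ?_⟩
  -- EVERY `[R', sgn·b/(2 Q v)]` is one change-of-variables move away from `r`
  intro R hR hRi
  refine KZ.changeOfVariablesRel_subset_relations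
    ⟨2, r, R, Φ, Φ', hΦsa, hderiv, hinj, hR.trans himage.symm, fun x hx => ?_, rfl⟩
  have hx' : Φ x ∈ R.domain := by
    rw [hR, ← himage]
    exact mem_image_of_mem Φ hx
  rw [hjac x hx, hRi hx']

end Summit.KontsevichZagierPeriods.HyperbolicBloch.OffTetraSectorKernel

end
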